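import Summits.ResolutionOfSingularities.ResolutionOfSingularities.Theorems.HilbertSamuelEliminationSigmaMaxModificationsCorridor3SigmaMenuSurfacePointStep
import HarnessLib

/-!
# [OURS · L1 W4.2] σ-LAYER PHASE B′ — `Corridor3SigmaMenuSurfacePointStepTS`: the F-75 POINT STEP against the TRUE-SET readiness of record
# (`ReadyTSOfRecord`, res-type-067 rev 2 p542978; o1's `StrategyE.surfacePhaseReadyTS`, p544886): READY-TS surfaces have `ℓ = 0` and no point step, and the
# (P1) tier `surfacePhaseReadyTS regular phaseS bad cure pointStepOfRecord` is stratum-disciplined with the `hpoint` binder DISCHARGED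
# (CHAIN w42 v3.22 §0u «stub-1: F-75c feed lemma + TS-readiness variant»; crux chain w42 `SigmaMaxModifications` stmt-ResolutionOfSingularities-18506 / conjunct
# `SigmaMaxModificationsCorridor3` stmt-ResolutionOfSingularities-19249; helper of res-L1-w42-stub-1 (gen 5), `--supports stmt-…-19249 --as helper`, counted 0)

HONEST FRAMING. OURS bookkeeping: one-line consequences of `…SigmaMenuSurfacePointStep` (p544431: `pointStepOfRecord_regular_subset`,
`surfaceSncLength_eq_zero_of_sncListOn`), res-type-067's `ReadyTSOfRecord` and res-L1-type-o1's `surfacePhaseReadyTS_*`. NOTHING here is a statement of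
H. Hironaka's manuscript [Hironaka2017] nor of [CossartJannsenSaito2020]; no named fact. AI-written; AI review is weaker than expert review.

## Contents (namespace `…Theorems.SigmaMaxModificationsCorridor3.Sigma`)

* `surfaceSncLength_eq_zero_of_readyTSOfRecord` (READY-TS ⇒ `ℓ(E, D) = 0`), `not_pointStepOfRecord_of_readyTSOfRecord` (the point step is SILENT on READY-TS
  surfaces — consistent with `surfaceProposal`'s first branch under the rev-2 readiness).
* **`StrategyE.surfacePhaseReadyTS_pointStep_isStratumDisciplined hS hcure`** + `_isFunctional`: o1's `surfacePhaseReadyTS_isStratumDisciplined` with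
  `point := pointStepOfRecord` and `hpoint` gone; `SurfacePrep.ofRecord_regular_subset_pointStep` of p544431 serves both readiness variants unchanged.

VACUITY SELF-CHECK. One-liners; the geometric content sits in `pointStepOfRecord_regular_subset` (regularity of a reduced closed point, `{ι q} ⊆ D ⊆ X(ν)`) and in
067's `ReadyTSOfRecord.sncListOn`.
-/

noncomputable section

set_option linter.dupNamespace false -- mandated namespace of this single-conjunct summit

open CategoryTheory AlgebraicGeometry TopologicalSpace
open Summit.ResolutionOfSingularities.ResolutionOfSingularities.Theorems.CampaignW42
open Literature.AlgebraicGeometry.Resolution Literature.RingTheory.HilbertSamuel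

namespace Summit.ResolutionOfSingularities.ResolutionOfSingularities.Theorems.SigmaMaxModificationsCorridor3.Sigma

universe u

open Scheme.IdealSheafData

variable {W : Scheme.{u}} {hW : IsLocallyNoetherian W} {N : ℕ} {ν : ℕ → ℕ} {L : Labelling W} {P : Option (Pending W)} {E : Boundary W} {D : Closeds W}
  {C : W.IdealSheafData}

/-- **READY-TS ⇒ `ℓ = 0`** (067's true-set readiness of record implies the rev-1 readiness, hence snc traces). [folklore] -/
theorem surfaceSncLength_eq_zero_of_readyTSOfRecord (h : ReadyTSOfRecord W E N ν D) : surfaceSncLength E D = 0 :=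
  surfaceSncLength_eq_zero_of_sncListOn h.sncListOn

/-- **No point step on a READY-TS surface.** [folklore] -/
theorem not_pointStepOfRecord_of_readyTSOfRecord (h : ReadyTSOfRecord W E N ν D) : ¬ pointStepOfRecord W hW N ν L P E D C :=
  not_pointStepOfRecord_of_readyOfRecord h.readyOfRecord

section Plugged

variable {regular : SurfaceRegularity.{u}} {phaseS : SurfacePrep.{u}} {bad : SurfaceBadness.{u}} {cure : SurfacePrep.{u}}

/-- **THE (P1) TIER WITH THE TRUE-SET READINESS AND THE F-75 POINT STEP IS STRATUM-DISCIPLINED** once PHASE S and the CURE propose regular centres inside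
`X(ν)` on their cases (o1's `surfacePhaseReadyTS_isStratumDisciplined`; `hpoint` discharged by `pointStepOfRecord_regular_subset`, `hReady` by 067's
`ReadyTSOfRecord.isRegular`). [folklore] -/
theorem StrategyE.surfacePhaseReadyTS_pointStep_isStratumDisciplined
    (hS : ∀ (W : Scheme.{u}) (hW : IsLocallyNoetherian W) (L : Labelling W) (P : Option (Pending W)) (E : Boundary W) (D : Closeds W)
      (C : W.IdealSheafData), (D : Set W) ∈ surfaceComponents W N ν → ¬ regular W D → phaseS W hW N ν L P E D C →
        Scheme.IsRegular C.subscheme ∧ (C.support : Set W) ⊆ Scheme.hsStratum W N ν)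
    (hcure : ∀ (W : Scheme.{u}) (hW : IsLocallyNoetherian W) (L : Labelling W) (P : Option (Pending W)) (E : Boundary W) (D : Closeds W)
      (C : W.IdealSheafData), (D : Set W) ∈ surfaceComponents W N ν → regular W D → 0 < bad W E D → cure W hW N ν L P E D C →
        Scheme.IsRegular C.subscheme ∧ (C.support : Set W) ⊆ Scheme.hsStratum W N ν) :
    (StrategyE.surfacePhaseReadyTS regular phaseS bad cure pointStepOfRecord).IsStratumDisciplined N ν :=
  StrategyE.surfacePhaseReadyTS_isStratumDisciplined hS hcure (pointStepOfRecord_regular_subset regular bad)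

/-- The same tier is functional (o1). [folklore] -/
theorem StrategyE.surfacePhaseReadyTS_pointStep_isFunctional (regular : SurfaceRegularity.{u}) (phaseS : SurfacePrep.{u}) (bad : SurfaceBadness.{u})
    (cure : SurfacePrep.{u}) (N : ℕ) (ν : ℕ → ℕ) : (StrategyE.surfacePhaseReadyTS regular phaseS bad cure pointStepOfRecord).IsFunctional N ν :=
  StrategyE.surfacePhaseReadyTS_isFunctional regular phaseS bad cure pointStepOfRecord N ν

end Plugged

end Summit.ResolutionOfSingularities.ResolutionOfSingularities.Theorems.SigmaMaxModificationsCorridor3.Sigma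

end
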